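import Mathlib.Combinatorics.SetFamily.Compression.Down
import Mathlib.Tactic
import HarnessLib
import HarnessLib.Audit.Tags
import Summits.CriticalPhenomena.PercolationContinuityZ3.Theorems.PercNearOneGluingNoHeavyLowerTailSahiRainbowTwoColourTwinPoint

/-!
# The two-colouring statement compresses, IV: twin certificates beyond the doubled configuration

Support file (seat `prim-masterthm-p1`, gen 41; `--supports stmt-CriticalPhenomena-4575`).  No `sorry`, standard axioms.
Companion of `…SahiRainbowTwoColourTwinPoint` (`SparseTwinPoint ∧ SmallTwoColourMeets ⟹ RainbowMeetCojoin`).  Memo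
`run/shared/lean/prim/prim-masterthm/FROM-prim-masterthm-p1-g41-TWO-COLOUR.md` §3, §6.

To prove `SparseTwinPoint` one must EXHIBIT twins (`w` with both `w` and `insert y w` monochromatic meets).  The key lemma of
`…TwoColourTwins` certifies the monochromatic meets of the upper-coloured doubled configuration; in the sparse residual these give
`p_y − 1` twins and one more is needed.  The censuses of this generation (`prim-masterthm-p1/code-g41/c/allbad6.c`, `design3.c`,
kit j301168: 1.5·10⁹ sampled sparse configurations on 6 points, all 960 rainbow 'all-dead' designs on 6 points) show that the missing
twin is always supplied by the following THREE-MEMBER mechanism (it also subsumes the 'collision × same-upper-colour' twins T4), except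
for one 48-element orbit on 4 points (cross-colour coincidences):

* `erase_mem_twins_of_third` — if `f, t, s` are three members of ONE colour class, `y ∈ f ∩ t`, `f ≠ t`, `y ∉ s` and
  `s ∩ f = (f ∩ t).erase y`, then `(f ∩ t).erase y` is a twin at `y` (lower lift `s ∩ f`, upper lift `f ∩ t`).
* `erase_mem_twins_of_third'` — the same with `s ∩ t = (f ∩ t).erase y`.
* `erase_mem_twins_of_superset` — the special case `f ⊆ t` (so `f ∩ t = f`): a member `f ∋ y` with a same-coloured strict superset and a
  same-coloured `y`-free member `s` with `s ∩ f = f.erase y` yields the twin `f.erase y` (the twin of the matching family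
  `{∅} ∪ {G∖y} ∪ M`, where the doubled-configuration certificate is exhausted).
HONEST FRAMING: certificates only; `SparseTwinPoint`, `TwoColourMeets`, `RainbowMeetCojoin` remain OPEN. [this work]
-/

namespace Summit.CriticalPhenomena.PercolationContinuityZ3.Theorems.SahiColouredDaykin

open Finset
open scoped FinsetFamily

variable {α : Type*} [DecidableEq α]

section Third

variable {X Y : Finset (Finset α)} {y : α} {f t s : Finset α}

/-- **Three-member twin (lower lift through `f`).**  Members `f, t, s ∈ X` with `y ∈ f ∩ t`, `f ≠ t`, `y ∉ s` and
`s ∩ f = (f ∩ t).erase y` certify the twin `(f ∩ t).erase y` at `y`. [this work] -/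
theorem erase_mem_twins_of_third (hf : f ∈ X) (ht : t ∈ X) (hs : s ∈ X) (hft : f ≠ t) (hyf : y ∈ f) (hyt : y ∈ t)
    (hys : y ∉ s) (hsf : s ∩ f = (f ∩ t).erase y) :
    (f ∩ t).erase y ∈ bothLifts (monoMeets X Y) y := by
  rw [mem_bothLifts]
  refine ⟨notMem_erase y _, ?_, ?_⟩
  · -- lower lift: `s ∩ f`
    have hsf' : s ≠ f := fun h => hys (h ▸ hyf)
    rw [← hsf]
    exact mem_monoMeets.2 (Or.inr (Or.inl (inter_mem_pairMeets hs hf hsf')))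
  · -- upper lift: `f ∩ t`
    rw [insert_erase (mem_inter.2 ⟨hyf, hyt⟩)]
    exact mem_monoMeets.2 (Or.inr (Or.inl (inter_mem_pairMeets hf ht hft)))

/-- **Three-member twin (lower lift through `t`).** [this work] -/
theorem erase_mem_twins_of_third' (hf : f ∈ X) (ht : t ∈ X) (hs : s ∈ X) (hft : f ≠ t) (hyf : y ∈ f) (hyt : y ∈ t)
    (hys : y ∉ s) (hst : s ∩ t = (f ∩ t).erase y) :
    (f ∩ t).erase y ∈ bothLifts (monoMeets X Y) y := by
  rw [inter_comm f t] at hst ⊢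
  exact erase_mem_twins_of_third ht hf hs hft.symm hyt hyf hys hst

/-- The same certificates in the second colour class. [this work] -/
theorem erase_mem_twins_of_third_right (hf : f ∈ Y) (ht : t ∈ Y) (hs : s ∈ Y) (hft : f ≠ t) (hyf : y ∈ f) (hyt : y ∈ t)
    (hys : y ∉ s) (hsf : s ∩ f = (f ∩ t).erase y) :
    (f ∩ t).erase y ∈ bothLifts (monoMeets X Y) y := by
  have := erase_mem_twins_of_third (X := Y) (Y := X) hf ht hs hft hyf hyt hys hsf
  rwa [monoMeets_comm Y X] at this

/-- **Nested special case.**  A member `f ∋ y` with a same-coloured strict superset `t` and a same-coloured `y`-free member `s` with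
`s ∩ f = f.erase y` gives the twin `f.erase y`. [this work] -/
theorem erase_mem_twins_of_superset (hf : f ∈ X) (ht : t ∈ X) (hs : s ∈ X) (hft : f ⊂ t) (hyf : y ∈ f) (hys : y ∉ s)
    (hsf : s ∩ f = f.erase y) : f.erase y ∈ bothLifts (monoMeets X Y) y := by
  have e : f ∩ t = f := inter_eq_left.2 hft.1
  have h := erase_mem_twins_of_third (Y := Y) hf ht hs (ne_of_ssubset hft) hyf (hft.1 hyf) hys (by rw [e]; exact hsf)
  rwa [e] at h

end Third

end Summit.CriticalPhenomena.PercolationContinuityZ3.Theorems.SahiColouredDaykin
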